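import Summits.ValiantsHypothesis.ValiantsHypothesis.Theorems.LacunarySymmetroidMatrixDescartesMomentLaw
import Summits.ValiantsHypothesis.ValiantsHypothesis.Theorems.LacunarySymmetroidMatrixDescartesStubNegRoots
import Summits.ValiantsHypothesis.ValiantsHypothesis.Theorems.LacunarySymmetroidMatrixDescartesStubArith4

/-!
# `MatrixDescartes` (stmt-ValiantsHypothesis-18050) — the negative-moment law in the CRUX'S OWN CURRENCY:
# all non-PSD mass at two ADJACENT exponents + one negative-definite scale ⇒ `Z₊ ≤ 2·n`

HONEST FRAMING.  Cell `pub-symmetroid`, seat `val-sym-mdr-p2` (gen 10); helper `--supports` the crux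
`Theses.LacunarySymmetroid.MatrixDescartes`, NO closure claim.  Companion and generalisation of `…MomentLaw.lean`
(p553044, `negMoment_posRoots_le`: pivot pencils `X^e J + ∑ X^{d k} P k` with a negative-definite moment have
`Z₊ ≤ 2·card ι`).  Nothing here bears on the crux in its window, on `stub_twoSided`, `DoorA26`/`DoorA34`, the cell's
registers, or `VP ≠ VNP`.

**THEOREM (`adjacentFree_posRoots_le`).**  Let `F(X) = ∑ l, X^{d l} S l` be a lacunary pencil of real symmetric
`ι × ι` matrices (any finite letter type `κ`, any exponents) and `c ∈ ℕ` such that every letter whose exponent is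
NOT in `{c, c+1}` is positive semidefinite — the letters at the two ADJACENT exponents `c`, `c+1` are ARBITRARY real
symmetric matrices, any number of them.  If `F(x₀)` is negative definite at one scale `x₀ > 0`, then `det F` has at
most `card ι` distinct zeros in `(0, x₀)`, none at `x₀`, at most `card ι` in `(x₀, ∞)`; hence `Z₊ ≤ 2·card ι`
(`adjacentFree_posRoots_below_le`, `adjacentFree_not_isRoot`, `adjacentFree_posRoots_above_le`).  The pivot law of
`…MomentLaw` is the case "no free letter at `c+1`"; in the crux's literal shape (`Fin K` letters of size `Fin m`):
`adjacentFree_posRoots_le_fin`; two-way form `adjacentFree_realRoots_le` (`F(X)` and `F(−X)` both in the sector ⇒ at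
most `4m + 1` distinct REAL zeros, tree `stub_negRoots`) and the crux's inequality on this format family at every fat
format, `adjacentFree_mdr` (`Z^q ≤ 2^(K⌊log₂K⌋)`, regime arithmetic `stub_arith4`).  This is the maximal reach of the
method in pencil currency: after the normalisation
`x^{-c}F(x)` a letter `x^{d−c} S` has convex Rayleigh forms for every symmetric `S` exactly when `d − c ∈ {0, 1}`
(constant or linear weight), and for PSD `S` always (integer powers are convex on `(0,∞)`).

PROOF.  As in `…MomentLaw`: every Rayleigh form of `H(x) = ∑ l, (x^{d l}/x^c) • S l` satisfies the three-point
secant inequality on `(0,∞)` (`MomentLawGeneral.secant_form`: equality for the letters at `c`, `c+1`, Mathlib's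
`convexOn_zpow` via `MomentLaw.secant_powDiv` for the PSD letters), a negative moment makes non-negativity propagate
strictly away from `x₀`, and the directed kernel chain of `…MomentLaw` (`MomentLaw.card_le_of_directed`) bounds the
roots on each side by `card ι`.  Elementary given p553044; axioms `propext`, `Classical.choice`, `Quot.sound`.
-/

-- layout Summits/ValiantsHypothesis/ValiantsHypothesis forces the duplicated namespace component
set_option linter.dupNamespace false

namespace Summit.ValiantsHypothesis.ValiantsHypothesis.Theorems.LacunarySymmetroidMatrixDescartes

open Polynomial Matrix Finset
open scoped BigOperators

namespace MomentLawGeneral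

variable {ι κ : Type} [Fintype ι] [Fintype κ]

omit [Fintype ι] in
/-- H-form of a general pencil: `x^c • ∑ (x^{d l}/x^c) • S l = ∑ x^{d l} • S l` for `x ≠ 0`. [folklore] -/
theorem smul_hform (c : ℕ) (d : κ → ℕ) (S : κ → Matrix ι ι ℝ) {x : ℝ} (hx : x ≠ 0) :
    x ^ c • (∑ l, (x ^ d l / x ^ c) • S l) = ∑ l, x ^ d l • S l := by
  rw [Finset.smul_sum]
  refine Finset.sum_congr rfl fun l _ => ?_
  rw [smul_smul, mul_div_cancel₀ _ (pow_ne_zero c hx)]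

/-- Evaluating the determinant of `∑ X^{d l} • S l` at a real point. [folklore] -/
theorem eval_det_pencil [DecidableEq ι] (d : κ → ℕ) (S : κ → Matrix ι ι ℝ) (x : ℝ) :
    (Matrix.det (∑ l, ((Polynomial.X : Polynomial ℝ) ^ d l) • (S l).map Polynomial.C)).eval x
      = Matrix.det (∑ l, x ^ d l • S l) := by
  have h := RingHom.map_det (Polynomial.evalRingHom x)
    (∑ l, ((Polynomial.X : Polynomial ℝ) ^ d l) • (S l).map Polynomial.C)
  rw [Polynomial.coe_evalRingHom] at h
  rw [h]
  congr 1
  ext i j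
  simp only [RingHom.mapMatrix_apply, Matrix.map_apply, Matrix.smul_apply, Matrix.sum_apply, smul_eq_mul,
    Polynomial.coe_evalRingHom, Polynomial.eval_mul, Polynomial.eval_pow, Polynomial.eval_X, Polynomial.eval_C,
    Polynomial.eval_finsetSum]

/-- At a nonzero point, `det H(x) = 0` iff `x` is a root of `det (∑ X^{d l} • S l)`. [folklore] -/
theorem det_hform_eq_zero_iff [DecidableEq ι] (c : ℕ) (d : κ → ℕ) (S : κ → Matrix ι ι ℝ) {x : ℝ}
    (hx : x ≠ 0) :
    (∑ l, (x ^ d l / x ^ c) • S l).det = 0 ↔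
      (Matrix.det (∑ l, ((Polynomial.X : Polynomial ℝ) ^ d l) • (S l).map Polynomial.C)).eval x = 0 := by
  rw [eval_det_pencil, ← smul_hform c d S hx, Matrix.det_smul, mul_eq_zero]
  constructor
  · exact fun h => Or.inr h
  · rintro (h | h)
    · exact absurd h (pow_ne_zero _ (pow_ne_zero _ hx))
    · exact h

/-- Rayleigh form of the H-form: `vᵀH(x)v = ∑ l, (x^{d l}/x^c)·vᵀS_l v`. [folklore] -/
theorem form_hform (c : ℕ) (d : κ → ℕ) (S : κ → Matrix ι ι ℝ) (v : ι → ℝ) (x : ℝ) :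
    v ⬝ᵥ ((∑ l, (x ^ d l / x ^ c) • S l) *ᵥ v) = ∑ l, (x ^ d l / x ^ c) * (v ⬝ᵥ (S l *ᵥ v)) := by
  rw [Matrix.sum_mulVec, dotProduct_sum]
  simp only [Matrix.smul_mulVec, dotProduct_smul, smul_eq_mul]

omit [Fintype ι] in
/-- The H-form of a pencil of symmetric letters is symmetric. [folklore] -/
theorem isSymm_hform (c : ℕ) (d : κ → ℕ) {S : κ → Matrix ι ι ℝ} (hS : ∀ l, (S l).IsSymm) (x : ℝ) :
    (∑ l, (x ^ d l / x ^ c) • S l).IsSymm := by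
  unfold Matrix.IsSymm
  rw [Matrix.transpose_sum]
  exact Finset.sum_congr rfl fun l _ => by rw [Matrix.transpose_smul, (hS l).eq]

/-- Per-letter secant relation for the weight `x ↦ x^d/x^c` times a real `q`, `0 < x < y < z`: an EQUALITY when
`d ∈ {c, c+1}` (constant or linear weight, any sign of `q`), the convexity INEQUALITY when `q ≥ 0`. [folklore] -/
theorem secant_term (c d : ℕ) (q : ℝ) (h : d = c ∨ d = c + 1 ∨ 0 ≤ q) {x y z : ℝ} (hx : 0 < x) (hxy : x < y)
    (hyz : y < z) :
    (z - x) * ((y ^ d / y ^ c) * q) ≤ (z - y) * ((x ^ d / x ^ c) * q) + (y - x) * ((z ^ d / z ^ c) * q) := by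
  have hy : 0 < y := hx.trans hxy
  have hz : 0 < z := hy.trans hyz
  rcases h with rfl | rfl | hq
  · rw [div_self (pow_ne_zero _ hx.ne'), div_self (pow_ne_zero _ hy.ne'), div_self (pow_ne_zero _ hz.ne')]
    linarith
  · rw [pow_succ, pow_succ, pow_succ, mul_div_cancel_left₀ _ (pow_ne_zero _ hx.ne'),
      mul_div_cancel_left₀ _ (pow_ne_zero _ hy.ne'), mul_div_cancel_left₀ _ (pow_ne_zero _ hz.ne')]
    nlinarith
  · have hsec := mul_le_mul_of_nonneg_right (MomentLaw.secant_powDiv d c hx hxy hyz) hq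
    nlinarith [hsec]

/-- **Three-point convexity of the Rayleigh forms**: letters off `{c, c+1}` PSD, letters at `c`, `c+1` arbitrary;
for every `v` and `0 < x < y < z`, `(z−x)φ_v(y) ≤ (z−y)φ_v(x) + (y−x)φ_v(z)`. [folklore] -/
theorem secant_form (c : ℕ) (d : κ → ℕ) {S : κ → Matrix ι ι ℝ}
    (hpsd : ∀ l, d l ≠ c → d l ≠ c + 1 → (S l).PosSemidef) (v : ι → ℝ) {x y z : ℝ} (hx : 0 < x)
    (hxy : x < y) (hyz : y < z) :
    (z - x) * (v ⬝ᵥ ((∑ l, (y ^ d l / y ^ c) • S l) *ᵥ v))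
      ≤ (z - y) * (v ⬝ᵥ ((∑ l, (x ^ d l / x ^ c) • S l) *ᵥ v))
        + (y - x) * (v ⬝ᵥ ((∑ l, (z ^ d l / z ^ c) • S l) *ᵥ v)) := by
  simp only [form_hform, Finset.mul_sum]
  rw [← Finset.sum_add_distrib]
  refine Finset.sum_le_sum fun l _ => secant_term c (d l) _ ?_ hx hxy hyz
  by_cases h0 : d l = c
  · exact Or.inl h0
  · by_cases h1 : d l = c + 1
    · exact Or.inr (Or.inl h1)
    · exact Or.inr (Or.inr (by simpa only [star_trivial] using (hpsd l h0 h1).dotProduct_mulVec_nonneg v))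

/-- Propagation above a negative moment. [folklore] -/
theorem propagate_above (c : ℕ) (d : κ → ℕ) {S : κ → Matrix ι ι ℝ}
    (hpsd : ∀ l, d l ≠ c → d l ≠ c + 1 → (S l).PosSemidef) {x₀ : ℝ} (hx₀ : 0 < x₀)
    (hneg : ∀ v : ι → ℝ, v ≠ 0 → v ⬝ᵥ ((∑ l, (x₀ ^ d l / x₀ ^ c) • S l) *ᵥ v) < 0)
    {y z : ℝ} (hy : x₀ < y) (hz : y < z) (v : ι → ℝ) (hv : v ≠ 0)
    (hvy : 0 ≤ v ⬝ᵥ ((∑ l, (y ^ d l / y ^ c) • S l) *ᵥ v)) :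
    0 < v ⬝ᵥ ((∑ l, (z ^ d l / z ^ c) • S l) *ᵥ v) := by
  have h := secant_form c d hpsd v hx₀ hy hz
  have h0 := hneg v hv
  by_contra hle
  push Not at hle
  nlinarith [mul_nonneg (sub_pos.2 (hy.trans hz)).le hvy, mul_pos (sub_pos.2 hz) (neg_pos.2 h0),
    mul_nonpos_iff.2 (Or.inl ⟨(sub_pos.2 hy).le, hle⟩)]

/-- Propagation below a negative moment. [folklore] -/
theorem propagate_below (c : ℕ) (d : κ → ℕ) {S : κ → Matrix ι ι ℝ}
    (hpsd : ∀ l, d l ≠ c → d l ≠ c + 1 → (S l).PosSemidef) {x₀ : ℝ}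
    (hneg : ∀ v : ι → ℝ, v ≠ 0 → v ⬝ᵥ ((∑ l, (x₀ ^ d l / x₀ ^ c) • S l) *ᵥ v) < 0)
    {y z : ℝ} (hz0 : 0 < z) (hz : z < y) (hy : y < x₀) (v : ι → ℝ) (hv : v ≠ 0)
    (hvy : 0 ≤ v ⬝ᵥ ((∑ l, (y ^ d l / y ^ c) • S l) *ᵥ v)) :
    0 < v ⬝ᵥ ((∑ l, (z ^ d l / z ^ c) • S l) *ᵥ v) := by
  have h := secant_form c d hpsd v hz0 hz hy
  have h0 := hneg v hv
  by_contra hle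
  push Not at hle
  nlinarith [mul_nonneg (sub_pos.2 (hz.trans hy)).le hvy, mul_pos (sub_pos.2 hz) (neg_pos.2 h0),
    mul_nonpos_iff.2 (Or.inl ⟨(sub_pos.2 hy).le, hle⟩)]

/-- The negative moment in H-form. [folklore] -/
theorem hform_neg_of_neg (c : ℕ) (d : κ → ℕ) (S : κ → Matrix ι ι ℝ) {x₀ : ℝ} (hx₀ : 0 < x₀)
    (hneg : ∀ v : ι → ℝ, v ≠ 0 → v ⬝ᵥ ((∑ l, x₀ ^ d l • S l) *ᵥ v) < 0) (v : ι → ℝ) (hv : v ≠ 0) :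
    v ⬝ᵥ ((∑ l, (x₀ ^ d l / x₀ ^ c) • S l) *ᵥ v) < 0 := by
  have h := hneg v hv
  rw [← smul_hform c d S hx₀.ne', Matrix.smul_mulVec, dotProduct_smul, smul_eq_mul] at h
  exact (mul_neg_iff.1 h).elim (fun h' => h'.2) fun h' => absurd h'.1 (not_lt.2 (pow_pos hx₀ c).le)

end MomentLawGeneral

open MomentLawGeneral

section Law

variable (ι κ : Type) [Fintype ι] [DecidableEq ι] [Fintype κ]

/-- No root at a negative moment (general pencil). [folklore] -/
theorem adjacentFree_not_isRoot (d : κ → ℕ) (S : κ → Matrix ι ι ℝ) {x₀ : ℝ} (hx₀ : 0 < x₀)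
    (hneg : ∀ v : ι → ℝ, v ≠ 0 → v ⬝ᵥ ((∑ l, x₀ ^ d l • S l) *ᵥ v) < 0) :
    ¬ (Matrix.det (∑ l, ((Polynomial.X : Polynomial ℝ) ^ d l) • (S l).map Polynomial.C)).IsRoot x₀ := by
  intro hroot
  have hdet : (∑ l, (x₀ ^ d l / x₀ ^ 0) • S l).det = 0 := (det_hform_eq_zero_iff 0 d S hx₀.ne').2 hroot
  obtain ⟨v, hv, hHv⟩ := Matrix.exists_mulVec_eq_zero_iff.2 hdet
  have h := hform_neg_of_neg 0 d S hx₀ hneg v hv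
  rw [hHv, dotProduct_zero] at h
  exact lt_irrefl 0 h

/-- **Upper half**: letters off `{c, c+1}` PSD, all letters symmetric, `F(x₀) ≺ 0` ⇒ at most `card ι` distinct zeros
of `det F` in `(x₀, ∞)`. [folklore] -/
theorem adjacentFree_posRoots_above_le (c : ℕ) (d : κ → ℕ) (S : κ → Matrix ι ι ℝ) (hS : ∀ l, (S l).IsSymm)
    (hpsd : ∀ l, d l ≠ c → d l ≠ c + 1 → (S l).PosSemidef) {x₀ : ℝ} (hx₀ : 0 < x₀)
    (hneg : ∀ v : ι → ℝ, v ≠ 0 → v ⬝ᵥ ((∑ l, x₀ ^ d l • S l) *ᵥ v) < 0) :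
    ((Matrix.det (∑ l, ((Polynomial.X : Polynomial ℝ) ^ d l) • (S l).map Polynomial.C)).roots.toFinset.filter
        (fun t => x₀ < t)).card ≤ Fintype.card ι := by
  set p := Matrix.det (∑ l, ((Polynomial.X : Polynomial ℝ) ^ d l) • (S l).map Polynomial.C) with hp
  by_cases hdet : p = 0
  · simp [hdet]
  set R := p.roots.toFinset.filter (fun t => x₀ < t) with hR
  let τ : Fin R.card ↪o ℝ := R.orderEmbOfFin rfl
  have hτmem : ∀ j, τ j ∈ R := fun j => R.orderEmbOfFin_mem rfl j
  have hτgt : ∀ j, x₀ < τ j := fun j => (Finset.mem_filter.1 (hτmem j)).2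
  have hτroot : ∀ j, p.IsRoot (τ j) := fun j => by
    have h1 := (Finset.mem_filter.1 (hτmem j)).1
    rw [Multiset.mem_toFinset] at h1
    exact (Polynomial.mem_roots hdet).1 h1
  have hneg' := hform_neg_of_neg c d S hx₀ hneg
  refine MomentLaw.card_le_of_directed (fun x => ∑ l, (x ^ d l / x ^ c) • S l) (fun s t => s < t) (Set.Ioi x₀)
    (fun s _ => isSymm_hform c d hS s) ?_ τ (fun j => hτgt j) (fun i j hij => τ.strictMono hij) ?_
  · intro s hs t _ hst x hx hsx
    exact propagate_above c d hpsd hx₀ hneg' hs hst x hx hsx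
  · intro j
    exact (det_hform_eq_zero_iff c d S (hx₀.trans (hτgt j)).ne').2 (hτroot j)

/-- **Lower half**: at most `card ι` distinct zeros of `det F` in `(0, x₀)`. [folklore] -/
theorem adjacentFree_posRoots_below_le (c : ℕ) (d : κ → ℕ) (S : κ → Matrix ι ι ℝ) (hS : ∀ l, (S l).IsSymm)
    (hpsd : ∀ l, d l ≠ c → d l ≠ c + 1 → (S l).PosSemidef) {x₀ : ℝ} (hx₀ : 0 < x₀)
    (hneg : ∀ v : ι → ℝ, v ≠ 0 → v ⬝ᵥ ((∑ l, x₀ ^ d l • S l) *ᵥ v) < 0) :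
    ((Matrix.det (∑ l, ((Polynomial.X : Polynomial ℝ) ^ d l) • (S l).map Polynomial.C)).roots.toFinset.filter
        (fun t => 0 < t ∧ t < x₀)).card ≤ Fintype.card ι := by
  set p := Matrix.det (∑ l, ((Polynomial.X : Polynomial ℝ) ^ d l) • (S l).map Polynomial.C) with hp
  by_cases hdet : p = 0
  · simp [hdet]
  set R := p.roots.toFinset.filter (fun t => 0 < t ∧ t < x₀) with hR
  let σ : Fin R.card ↪o ℝ := R.orderEmbOfFin rfl
  let τ : Fin R.card → ℝ := fun j => σ (Fin.rev j)
  have hτmem : ∀ j, τ j ∈ R := fun j => R.orderEmbOfFin_mem rfl (Fin.rev j)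
  have hτpos : ∀ j, 0 < τ j := fun j => (Finset.mem_filter.1 (hτmem j)).2.1
  have hτlt : ∀ j, τ j < x₀ := fun j => (Finset.mem_filter.1 (hτmem j)).2.2
  have hτroot : ∀ j, p.IsRoot (τ j) := fun j => by
    have h1 := (Finset.mem_filter.1 (hτmem j)).1
    rw [Multiset.mem_toFinset] at h1
    exact (Polynomial.mem_roots hdet).1 h1
  have hτanti : ∀ i j : Fin R.card, i < j → τ j < τ i := fun i j hij =>
    σ.strictMono (Fin.rev_lt_rev.2 hij)
  have hneg' := hform_neg_of_neg c d S hx₀ hneg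
  refine MomentLaw.card_le_of_directed (fun x => ∑ l, (x ^ d l / x ^ c) • S l) (fun s t => t < s)
    (Set.Ioo 0 x₀) (fun s _ => isSymm_hform c d hS s) ?_ τ (fun j => ⟨hτpos j, hτlt j⟩) hτanti ?_
  · intro s hs t ht hts x hx hsx
    exact propagate_below c d hpsd hneg' ht.1 hts hs.2 x hx hsx
  · intro j
    exact (det_hform_eq_zero_iff c d S (hτpos j).ne').2 (hτroot j)

/-- **THE NEGATIVE-MOMENT LAW, general currency.**  `F(X) = ∑ l, X^{d l} S l`, all `S l` real symmetric, every letter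
with exponent outside `{c, c+1}` positive semidefinite (letters AT `c` and `c+1` arbitrary).  If `F(x₀)` is negative
definite at one `x₀ > 0` then `det F` has at most `2·card ι` distinct positive zeros (at most `card ι` on each side of
`x₀`, none at `x₀`). [folklore] -/
theorem adjacentFree_posRoots_le (c : ℕ) (d : κ → ℕ) (S : κ → Matrix ι ι ℝ) (hS : ∀ l, (S l).IsSymm)
    (hpsd : ∀ l, d l ≠ c → d l ≠ c + 1 → (S l).PosSemidef) (x₀ : ℝ) (hx₀ : 0 < x₀)
    (hneg : ∀ v : ι → ℝ, v ≠ 0 → v ⬝ᵥ ((∑ l, x₀ ^ d l • S l) *ᵥ v) < 0) :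
    ((Matrix.det (∑ l, ((Polynomial.X : Polynomial ℝ) ^ d l) • (S l).map Polynomial.C)).roots.toFinset.filter
        (fun t => 0 < t)).card ≤ 2 * Fintype.card ι := by
  set p := Matrix.det (∑ l, ((Polynomial.X : Polynomial ℝ) ^ d l) • (S l).map Polynomial.C) with hp
  have hsplit : p.roots.toFinset.filter (fun t => 0 < t)
      ⊆ p.roots.toFinset.filter (fun t => 0 < t ∧ t < x₀) ∪ p.roots.toFinset.filter (fun t => x₀ < t) := by
    intro t ht
    rw [Finset.mem_filter] at ht
    rw [Finset.mem_union, Finset.mem_filter, Finset.mem_filter]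
    rcases lt_trichotomy t x₀ with h | h | h
    · exact Or.inl ⟨ht.1, ht.2, h⟩
    · exfalso
      subst h
      have hmem := ht.1
      rw [Multiset.mem_toFinset] at hmem
      by_cases hdet : p = 0
      · rw [hdet, Polynomial.roots_zero] at hmem
        exact Multiset.notMem_zero _ hmem
      · exact adjacentFree_not_isRoot ι κ d S ht.2 hneg ((Polynomial.mem_roots hdet).1 hmem)
    · exact Or.inr ⟨ht.1, h⟩
  calc (p.roots.toFinset.filter (fun t => 0 < t)).card
      ≤ (p.roots.toFinset.filter (fun t => 0 < t ∧ t < x₀) ∪ p.roots.toFinset.filter (fun t => x₀ < t)).card :=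
        Finset.card_le_card hsplit
    _ ≤ (p.roots.toFinset.filter (fun t => 0 < t ∧ t < x₀)).card
          + (p.roots.toFinset.filter (fun t => x₀ < t)).card := Finset.card_union_le _ _
    _ ≤ Fintype.card ι + Fintype.card ι :=
        Nat.add_le_add (adjacentFree_posRoots_below_le ι κ c d S hS hpsd hx₀ hneg)
          (adjacentFree_posRoots_above_le ι κ c d S hS hpsd hx₀ hneg)
    _ = 2 * Fintype.card ι := by ring

end Law

/-- **The law in the crux's literal shape** (`K` letters `S : Fin K → Matrix (Fin m) (Fin m) ℝ`, exponents
`d : Fin K → ℕ`, as in `Theses.LacunarySymmetroid.MatrixDescartes`): symmetric letters, PSD off two adjacent exponents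
`c, c+1`, negative definite at one `x₀ > 0` ⇒ at most `2m` distinct positive zeros of the determinant — for every
format `(m, K)` and all exponents. [folklore] -/
theorem adjacentFree_posRoots_le_fin (K m c : ℕ) (d : Fin K → ℕ) (S : Fin K → Matrix (Fin m) (Fin m) ℝ)
    (hS : ∀ l, (S l).IsSymm) (hpsd : ∀ l, d l ≠ c → d l ≠ c + 1 → (S l).PosSemidef) (x₀ : ℝ) (hx₀ : 0 < x₀)
    (hneg : ∀ v : Fin m → ℝ, v ≠ 0 → v ⬝ᵥ ((∑ l, x₀ ^ d l • S l) *ᵥ v) < 0) :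
    ((Matrix.det (∑ l, ((Polynomial.X : Polynomial ℝ) ^ d l) • (S l).map Polynomial.C)).roots.toFinset.filter
        (fun t => 0 < t)).card ≤ 2 * m := by
  simpa using adjacentFree_posRoots_le (Fin m) (Fin K) c d S hS hpsd x₀ hx₀ hneg


/-- **Real zeros, two-way form.**  If `F(X) = ∑ₗ X^{dₗ} Sₗ` is in the sector (symmetric letters, PSD off `{c, c+1}`,
negative definite at some `x₀ > 0`) and the reflected pencil `F(−X) = ∑ₗ X^{dₗ} ((−1)^{dₗ} Sₗ)` is in the sector for
some `c'`, `x₁ > 0`, then `det F` has at most `4m + 1` distinct REAL zeros (positive zeros of `F`, of `F(−X)`, and the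
origin; tree `stub_negRoots`). [folklore] -/
theorem adjacentFree_realRoots_le (K m c c' : ℕ) (d : Fin K → ℕ) (S : Fin K → Matrix (Fin m) (Fin m) ℝ)
    (hS : ∀ l, (S l).IsSymm) (hpsd : ∀ l, d l ≠ c → d l ≠ c + 1 → (S l).PosSemidef)
    (hpsd' : ∀ l, d l ≠ c' → d l ≠ c' + 1 → (((-1 : ℝ) ^ d l) • S l).PosSemidef)
    (x₀ x₁ : ℝ) (hx₀ : 0 < x₀) (hx₁ : 0 < x₁)
    (hneg : ∀ v : Fin m → ℝ, v ≠ 0 → v ⬝ᵥ ((∑ l, x₀ ^ d l • S l) *ᵥ v) < 0)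
    (hneg' : ∀ v : Fin m → ℝ, v ≠ 0 → v ⬝ᵥ ((∑ l, x₁ ^ d l • (((-1 : ℝ) ^ d l) • S l)) *ᵥ v) < 0) :
    (Matrix.det (∑ l, ((Polynomial.X : Polynomial ℝ) ^ d l) • (S l).map Polynomial.C)).roots.toFinset.card
      ≤ 4 * m + 1 := by
  have h1 := adjacentFree_posRoots_le_fin K m c d S hS hpsd x₀ hx₀ hneg
  have h2 := adjacentFree_posRoots_le_fin K m c' d (fun l => ((-1 : ℝ) ^ d l) • S l)
    (fun l => (hS l).smul _) hpsd' x₁ hx₁ hneg'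
  have h3 := stub_negRoots K m d S
  omega

/-- Regime arithmetic: in the crux's size range `m ≤ 2^((⌊log₂K⌋+c₀)^c₀)`, a root count `Z ≤ 4m + 1` gives
`Z^q ≤ 2^(K⌊log₂K⌋)` for all large `K` (tree `stub_arith4`). [folklore] -/
theorem fourLinearCount_absorbed (c₀ q : ℕ) : ∃ K₁ : ℕ, ∀ K m Z : ℕ, K₁ ≤ K →
    m ≤ 2 ^ ((Nat.log 2 K + c₀) ^ c₀) → Z ≤ 4 * m + 1 → Z ^ q ≤ 2 ^ (K * Nat.log 2 K) := by
  obtain ⟨K₁, hK₁⟩ := stub_arith4 c₀ (2 * q)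
  refine ⟨max K₁ (max 32 (5 * q)), fun K m Z hK hm hZ => ?_⟩
  have hK₁K : K₁ ≤ K := le_trans (le_max_left _ _) hK
  have hK32 : 32 ≤ K := le_trans (le_trans (le_max_left _ _) (le_max_right _ _)) hK
  have hKq : 5 * q ≤ K := le_trans (le_trans (le_max_right _ _) (le_max_right _ _)) hK
  have hlog : 5 ≤ Nat.log 2 K := by
    calc 5 = Nat.log 2 32 := by decide
      _ ≤ Nat.log 2 K := Nat.log_mono_right hK32
  rcases le_or_gt 5 m with hm5 | hm5
  · have hZm : Z ≤ m ^ 2 := by nlinarith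
    calc Z ^ q ≤ (m ^ 2) ^ q := Nat.pow_le_pow_left hZm q
      _ = m ^ (2 * q) := by rw [← pow_mul]
      _ ≤ 2 ^ (K * Nat.log 2 K) := hK₁ K m hK₁K hm
  · have hZ5 : Z ≤ 2 ^ 5 := by omega
    calc Z ^ q ≤ (2 ^ 5) ^ q := Nat.pow_le_pow_left hZ5 q
      _ = 2 ^ (5 * q) := by rw [← pow_mul]
      _ ≤ 2 ^ (K * Nat.log 2 K) := Nat.pow_le_pow_right (by norm_num) (by nlinarith)

/-- **`MatrixDescartes` holds on the two-way negative-moment sector, at every fat format.**  For all `c₀, q` there is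
`K₀` such that for all `K ≥ K₀`, all `m ≤ 2^((⌊log₂K⌋+c₀)^c₀)`, all exponents `d : Fin K → ℕ` and all real symmetric
letters `Sₗ` such that `F(X) = ∑ X^{dₗ} Sₗ` and `F(−X)` lie in the sector (PSD letters off two adjacent exponents, a
negative-definite scale each), the number `Z` of distinct real zeros of `det F` satisfies `Z^q ≤ 2^(K⌊log₂K⌋)` — the
crux's inequality restricted to this format family and proved there unconditionally.  Nothing is claimed outside the
family. [folklore] -/
theorem adjacentFree_mdr (c₀ q : ℕ) : ∃ K₀ : ℕ, ∀ K m : ℕ, K₀ ≤ K → m ≤ 2 ^ ((Nat.log 2 K + c₀) ^ c₀) →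
    ∀ (c c' : ℕ) (d : Fin K → ℕ) (S : Fin K → Matrix (Fin m) (Fin m) ℝ) (x₀ x₁ : ℝ),
      (∀ l, (S l).IsSymm) → (∀ l, d l ≠ c → d l ≠ c + 1 → (S l).PosSemidef) →
      (∀ l, d l ≠ c' → d l ≠ c' + 1 → (((-1 : ℝ) ^ d l) • S l).PosSemidef) → 0 < x₀ → 0 < x₁ →
      (∀ v : Fin m → ℝ, v ≠ 0 → v ⬝ᵥ ((∑ l, x₀ ^ d l • S l) *ᵥ v) < 0) →
      (∀ v : Fin m → ℝ, v ≠ 0 → v ⬝ᵥ ((∑ l, x₁ ^ d l • (((-1 : ℝ) ^ d l) • S l)) *ᵥ v) < 0) →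
      (Matrix.det (∑ l, ((Polynomial.X : Polynomial ℝ) ^ d l) • (S l).map Polynomial.C)).roots.toFinset.card ^ q
        ≤ 2 ^ (K * Nat.log 2 K) := by
  obtain ⟨K₁, hK₁⟩ := fourLinearCount_absorbed c₀ q
  exact ⟨K₁, fun K m hK hm c c' d S x₀ x₁ hS hpsd hpsd' hx₀ hx₁ hneg hneg' =>
    hK₁ K m _ hK hm (adjacentFree_realRoots_le K m c c' d S hS hpsd hpsd' x₀ x₁ hx₀ hx₁ hneg hneg')⟩

end Summit.ValiantsHypothesis.ValiantsHypothesis.Theorems.LacunarySymmetroidMatrixDescartes
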